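import Summits.HubbardSuperconductivity.HubbardSuperconductivity.Theses.ParityGapRigidity
import Summits.HubbardSuperconductivity.HubbardSuperconductivity.Theorems.ParityGapRigidityParityGapClustering
import Summits.HubbardSuperconductivity.HubbardSuperconductivity.Theorems.ParityGapRigidityIncommensurateRigidityFiniteRange
import HarnessLib

/-!
# `¬ IncommensurateRigidity` modulo a parity-gapped, fluctuation-normal, NON-superconducting window
# (crux R of route ParityGapRigidity = stmt-HubbardSuperconductivity-2195; negative lemma, `--negative-modulo`)

The route's own KILL CRITERION for its bet R ("a lattice model obeying (H1)–(H4) at non-integer filling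
with provably no ODLRO kills R's mechanism"; item docstring: "false if the t'=0 Hubbard model has at some
(U,δ) a z=1 featureless pair liquid or a fermion-gapped critical point obeying (H1)-(H4) without
condensate"), typed as ONE closed hypothesis over the route's finite-volume vocabulary, and the
implication it names, kernel-checked:

* `ParityGappedNonsuperconductingWindow` (HYPOTHESIS H, NOT constructible in the tree today): some
  `U > 0`, `δ ∈ (0, 1/2)` at which, uniformly in even `L ≥ L₀`, the pure model has (PG) the uniform
  one-particle PARITY GAP `E(N_L+1) + E(N_L−1) − 2E₀(N_L,0) ≥ 2Δ > 0` (verbatim the first clause of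
  `GappedWindow`, energies only — the route's refuter instrument), (H2) normal range-`≤ 1` one-body
  fluctuations, (H3) at most `D` in-sector levels below `E₀ + c/L`, (H4) soft pair staircase (all three
  verbatim as in R), and (¬Y) NO uniform Yang ODLRO: for every `a > 0`, for infinitely many even `L`, some
  normalised `(N_L,0)`-sector ground state `ψ` has `Re v†ρ₂(ψ)v < a·L²` for every unit pair wavefunction
  `v` (verbatim the negation of R's conclusion at `(U, δ)`).
* `IncommensurateRigidity_false_of_ParityGappedNonsuperconductingWindow : H → ¬ R`: the parity gap gives
  (H1) by the PROVED route lemma `parityGapClustering_proof` (stmt-2197, sector-relative Hastings–Koma), R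
  then asserts uniform Yang ODLRO at `(U, δ)`, contradicting (¬Y).
* `not_irrational_finiteRange_window_of_etsTrichotomy`: WHERE such an H can live, modulo the programme's
  filed named conjecture `AnomalyExhaustion.EtsTrichotomy` (stmt-1458): NOT at irrational `δ` with (H2) read
  at every finite range — there the parity gap + finite-range normal fluctuations already force uniform
  Yang ODLRO (`yangODLRO_of_etsTrichotomy_of_finiteRangeFluctuations`, lead c9). So, modulo stmt-1458, a
  refuting window needs RATIONAL doping `δ = p/q` (gapped `Z_q` pair liquids and their critical end
  points — the refuters' articulated kill scenarios, route reviews 2bdd7c93 / c7 §3) or a particle–hole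
  density wave living only in ranges `≥ 2` (outside the typed (H2)).

Why H is not constructible here: each conjunct is a certified, uniform-in-`L` statement about TRUE
sector ground states / sector energies of the doped two-dimensional repulsive Hubbard torus at an
explicit `(U, δ)` — a uniform parity gap, variance bounds for every sector ground state, an in-sector
level count, pair-addition curvature, and the failure of pair condensation infinitely often. No
expansion reaches `T = 0` at fixed `U > 0` (barriers `WeakCouplingCeiling`, `PerturbativeInvisibilityOfPairing`),
there is no reflection positivity or sign structure off half filling (`GeneralizedHartreeFockNoPairing`,
`SignProblemNPHard`), and exact diagonalisation reaches `L ≤ 4`; moreover no such window is even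
EXPECTED for the pure `t' = 0` model (believed d-wave superconducting or striped — stripes violate (H2)).
The lemma records precisely what a refutation of the `∀ (U, δ)` crux must establish and nothing more;
it does not bear on the truth of R. Ten line leads (c1–c10, 2026-08-17) found R's one open stub
(`stub_kohnStiffnessFC`, a converse Lieb–Schultz–Mattis stiffness floor) conjecture-class; see
`Cruxes/IncommensurateRigidity/Lines/registered-dead*.md`.

Sources: the route file (kill criteria; `GappedWindow`, `IncommensurateRigidity`, `ParityGapClustering`);
K. A. Matveev, A. I. Larkin, Phys. Rev. Lett. 78 (1997) 3749 (parity gap); C. N. Yang, Rev. Mod. Phys. 34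
(1962) 694 (ODLRO, `λ_max(ρ₂)`); D. V. Else, R. Thorngren, T. Senthil, Phys. Rev. X 11 (2021) 021005.
Pure logic over landed theorems; no model content.
-/

noncomputable section

set_option linter.dupNamespace false -- `Summit.<S>.<S>` doubles the summit name (tree convention)

namespace Summit.HubbardSuperconductivity.HubbardSuperconductivity.Theorems.IncommensurateRigidity.Negative

open scoped BigOperators Matrix
open Filter Literature.MathematicalPhysics.QuantumLattice Literature.Probability.LatticeModels
open Summit.HubbardSuperconductivity.HubbardSuperconductivity.Theses.ParityGapRigidity
  (IncommensurateRigidity ParityGapClustering)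

/-- HYPOTHESIS H — **a parity-gapped, fluctuation-normal, non-superconducting window of the pure
model** (the route's kill criterion for R, typed; NOT constructible in the tree today). Some `U > 0`,
`δ ∈ (0, 1/2)` such that, with `N_L = 2⌊(1 − δ)L²/2⌋` and uniformly in even `L ≥ L₀`:
(PG) `2Δ ≤ E(N_L+1) + E(N_L−1) − 2E₀(N_L, 0)` for some `Δ > 0` (verbatim the parity-gap clause of
`GappedWindow`); (H2) `Re⟨A†A⟩_ψ − |⟨A⟩_ψ|² ≤ C L²` for every normalised `(N_L,0)`-sector ground state
`ψ` and every one-body `A = Σ a(p) c†_{p₁}c_{p₂}`, `|a| ≤ 1`, supported on pairs at torus distance `≤ 1`;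
(H3) every subspace of the sector with Rayleigh quotients `≤ E₀ + c/L` has dimension `≤ D`;
(H4) `E(N_L ± 2) − ½[E(N_L) + E(N_L ± 4)] ≤ C/L²` ((H2)–(H4) verbatim as in `IncommensurateRigidity`);
and (¬Y) for every `a > 0` and every `L₁` there are an even `L ≥ L₁` and a normalised `(N_L,0)`-sector
ground state `ψ` of `hubbardTorus 2 L 1 U` with `Re v†ρ₂(ψ)v < a L²` for every unit `v` (the negation
of R's conclusion at `(U, δ)`). [topic: MathematicalPhysics/QuantumLattice] -/
def ParityGappedNonsuperconductingWindow : Prop :=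
  ∃ U : ℝ, 0 < U ∧ ∃ δ ∈ Set.Ioo (0 : ℝ) (1 / 2),
    (∃ Δ : ℝ, 0 < Δ ∧ ∃ L₀ : ℕ, ∀ L ≥ L₀, Even L → ∀ Hm, Hm = hubbardTorus 2 L 1 U →
      2 * Δ ≤ groundEnergy Hm (2 * ⌊(1 - δ) * (L : ℝ) ^ 2 / 2⌋₊ + 1) +
        groundEnergy Hm (2 * ⌊(1 - δ) * (L : ℝ) ^ 2 / 2⌋₊ - 1) -
        2 * Matrix.minEnergyOn Hm (szSector (2 * ⌊(1 - δ) * (L : ℝ) ^ 2 / 2⌋₊) 0)) ∧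
    (∃ C : ℝ, ∃ L₀ : ℕ, ∀ L ≥ L₀, Even L → ∀ Hm, Hm = hubbardTorus 2 L 1 U → ∀ ψ,
      IsGroundStateInSector Hm (2 * ⌊(1 - δ) * (L : ℝ) ^ 2 / 2⌋₊) 0 ψ → star ψ ⬝ᵥ ψ = 1 →
      ∀ a : Orb (FermionTorus 2 L) × Orb (FermionTorus 2 L) → ℂ, (∀ p, ‖a p‖ ≤ 1) →
        (∀ p, a p ≠ 0 → torusDist (ofLex p.1).1.toTorusSite (ofLex p.2).1.toTorusSite ≤ 1) →
        (expect (Matrix.conjTranspose (∑ p, a p • (creation p.1 * annihilation p.2)) *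
            (∑ p, a p • (creation p.1 * annihilation p.2))) ψ).re -
          ‖expect (∑ p, a p • (creation p.1 * annihilation p.2)) ψ‖ ^ 2 ≤ C * (L : ℝ) ^ 2) ∧
    (∃ c : ℝ, 0 < c ∧ ∃ D L₀ : ℕ, ∀ L ≥ L₀, Even L → ∀ Hm, Hm = hubbardTorus 2 L 1 U →
      ∀ V : Submodule ℂ (Fock (Orb (FermionTorus 2 L))),
        V ≤ szSector (2 * ⌊(1 - δ) * (L : ℝ) ^ 2 / 2⌋₊) 0 →
        (∀ φ ∈ V, (star φ ⬝ᵥ Matrix.mulVec Hm φ).re ≤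
          (Matrix.minEnergyOn Hm (szSector (2 * ⌊(1 - δ) * (L : ℝ) ^ 2 / 2⌋₊) 0) + c / (L : ℝ)) *
            (star φ ⬝ᵥ φ).re) →
        Module.finrank ℂ V ≤ D) ∧
    (∃ C : ℝ, ∃ L₀ : ℕ, ∀ L ≥ L₀, Even L → ∀ Hm, Hm = hubbardTorus 2 L 1 U →
      ∀ (E : ℕ → ℝ) (n : ℕ), E = groundEnergy Hm → n = 2 * ⌊(1 - δ) * (L : ℝ) ^ 2 / 2⌋₊ →
        E (n + 2) - (E n + E (n + 4)) / 2 ≤ C / (L : ℝ) ^ 2 ∧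
          E (n - 2) - (E n + E (n - 4)) / 2 ≤ C / (L : ℝ) ^ 2) ∧
    (∀ a : ℝ, 0 < a → ∀ L₁ : ℕ, ∃ L ≥ L₁, Even L ∧ ∃ ψ : Fock (Orb (FermionTorus 2 L)),
      IsGroundStateInSector (hubbardTorus 2 L 1 U) (2 * ⌊(1 - δ) * (L : ℝ) ^ 2 / 2⌋₊) 0 ψ ∧
      star ψ ⬝ᵥ ψ = 1 ∧
      ∀ v : Orb (FermionTorus 2 L) × Orb (FermionTorus 2 L) → ℂ, star v ⬝ᵥ v = 1 →
        (star v ⬝ᵥ Matrix.mulVec (twoParticleRDM ψ) v).re < a * (L : ℝ) ^ 2)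

/-- **From the parity gap to (H1).** At any `(U, δ)`, a uniform parity gap `2Δ` along the even sides
`L ≥ L₀` gives R's hypothesis (H1) (exponentially decaying one-particle density matrix of every
normalised `(N_L,0)`-sector ground state, constants uniform in `L`) — by the PROVED route lemma
`parityGapClustering_proof` (stmt-2197), exactly as in the route's deciding theorem `closes`. [folklore] -/
theorem expDecayRDM_of_parityGap (U δ : ℝ) {Δ : ℝ} (hΔ : 0 < Δ) {L₀ : ℕ}
    (hPG : ∀ L ≥ L₀, Even L → ∀ Hm, Hm = hubbardTorus 2 L 1 U →
      2 * Δ ≤ groundEnergy Hm (2 * ⌊(1 - δ) * (L : ℝ) ^ 2 / 2⌋₊ + 1) +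
        groundEnergy Hm (2 * ⌊(1 - δ) * (L : ℝ) ^ 2 / 2⌋₊ - 1) -
        2 * Matrix.minEnergyOn Hm (szSector (2 * ⌊(1 - δ) * (L : ℝ) ^ 2 / 2⌋₊) 0)) :
    ∃ C m : ℝ, 0 < m ∧ ∃ L₀ : ℕ, ∀ L ≥ L₀, Even L → ∀ Hm, Hm = hubbardTorus 2 L 1 U → ∀ ψ,
      IsGroundStateInSector Hm (2 * ⌊(1 - δ) * (L : ℝ) ^ 2 / 2⌋₊) 0 ψ → star ψ ⬝ᵥ ψ = 1 →
      ∀ (x y : FermionTorus 2 L) (σ τ : Fin 2),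
        ‖oneParticleRDM ψ (orb x σ) (orb y τ)‖ ≤
          C * Real.exp (-(m * (torusDist x.toTorusSite y.toTorusSite : ℝ))) := by
  obtain ⟨C, m, hm, hclus⟩ :=
    Summit.HubbardSuperconductivity.HubbardSuperconductivity.Theorems.parityGapClustering_proof U Δ hΔ
  exact ⟨C, m, hm, L₀, fun L hLL hev Hm hHm φ hgs hn =>
    hclus L _ Hm hHm φ hgs hn (hPG L hLL hev Hm hHm)⟩

/-- **THE NEGATIVE LEMMA: a parity-gapped, fluctuation-normal, non-superconducting window of the pure
model refutes `IncommensurateRigidity`.** H supplies `(U, δ)` with (PG), (H2), (H3), (H4) and (¬Y);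
the parity gap gives (H1) (`expDecayRDM_of_parityGap`); the crux R at `(U, δ)` then yields `a > 0` and
`L₁` with `a L² ≤ Re v†ρ₂(ψ)v` for some unit `v`, for EVERY normalised sector ground state `ψ` at every
even `L ≥ L₁`; (¬Y) at this `a`, `L₁` produces an even `L ≥ L₁` and a ground state where every unit `v`
has `Re v†ρ₂(ψ)v < a L²` — contradiction. [folklore] -/
theorem IncommensurateRigidity_false_of_ParityGappedNonsuperconductingWindow
    (hH : ParityGappedNonsuperconductingWindow) : ¬ IncommensurateRigidity := by
  intro hR
  obtain ⟨U, hU, δ, hδ, ⟨Δ, hΔ, L₀, hPG⟩, h2, h3, h4, hno⟩ := hH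
  obtain ⟨a, ha, L₁, hY⟩ := hR U δ hU hδ (expDecayRDM_of_parityGap U δ hΔ hPG) h2 h3 h4
  obtain ⟨L, hL, hev, ψ, hgs, hn, hlt⟩ := hno a ha L₁
  obtain ⟨v, hv, hav⟩ := hY L hL hev _ rfl ψ hgs hn
  exact absurd hav (not_le.mpr (hlt v hv))

/-- The same with R's own hypothesis (H1) in place of the parity gap (pure logic; recorded so that the
hypothesis package of the lemma above is seen to differ from `¬R` exactly by the PROVED step PG ⟹ (H1)):
(H1) ∧ (H2) ∧ (H3) ∧ (H4) ∧ (¬Y) at some `(U, δ)` refutes R. [folklore] -/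
theorem IncommensurateRigidity_false_of_hypotheses_of_noYangODLRO (U δ : ℝ) (hU : 0 < U)
    (hδ : δ ∈ Set.Ioo (0 : ℝ) (1 / 2))
    (h1 : ∃ C m : ℝ, 0 < m ∧ ∃ L₀ : ℕ, ∀ L ≥ L₀, Even L → ∀ Hm, Hm = hubbardTorus 2 L 1 U → ∀ ψ,
      IsGroundStateInSector Hm (2 * ⌊(1 - δ) * (L : ℝ) ^ 2 / 2⌋₊) 0 ψ → star ψ ⬝ᵥ ψ = 1 →
      ∀ (x y : FermionTorus 2 L) (σ τ : Fin 2),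
        ‖oneParticleRDM ψ (orb x σ) (orb y τ)‖ ≤
          C * Real.exp (-(m * (torusDist x.toTorusSite y.toTorusSite : ℝ))))
    (h2 : ∃ C : ℝ, ∃ L₀ : ℕ, ∀ L ≥ L₀, Even L → ∀ Hm, Hm = hubbardTorus 2 L 1 U → ∀ ψ,
      IsGroundStateInSector Hm (2 * ⌊(1 - δ) * (L : ℝ) ^ 2 / 2⌋₊) 0 ψ → star ψ ⬝ᵥ ψ = 1 →
      ∀ a : Orb (FermionTorus 2 L) × Orb (FermionTorus 2 L) → ℂ, (∀ p, ‖a p‖ ≤ 1) →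
        (∀ p, a p ≠ 0 → torusDist (ofLex p.1).1.toTorusSite (ofLex p.2).1.toTorusSite ≤ 1) →
        (expect (Matrix.conjTranspose (∑ p, a p • (creation p.1 * annihilation p.2)) *
            (∑ p, a p • (creation p.1 * annihilation p.2))) ψ).re -
          ‖expect (∑ p, a p • (creation p.1 * annihilation p.2)) ψ‖ ^ 2 ≤ C * (L : ℝ) ^ 2)
    (h3 : ∃ c : ℝ, 0 < c ∧ ∃ D L₀ : ℕ, ∀ L ≥ L₀, Even L → ∀ Hm, Hm = hubbardTorus 2 L 1 U →
      ∀ V : Submodule ℂ (Fock (Orb (FermionTorus 2 L))),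
        V ≤ szSector (2 * ⌊(1 - δ) * (L : ℝ) ^ 2 / 2⌋₊) 0 →
        (∀ φ ∈ V, (star φ ⬝ᵥ Matrix.mulVec Hm φ).re ≤
          (Matrix.minEnergyOn Hm (szSector (2 * ⌊(1 - δ) * (L : ℝ) ^ 2 / 2⌋₊) 0) + c / (L : ℝ)) *
            (star φ ⬝ᵥ φ).re) →
        Module.finrank ℂ V ≤ D)
    (h4 : ∃ C : ℝ, ∃ L₀ : ℕ, ∀ L ≥ L₀, Even L → ∀ Hm, Hm = hubbardTorus 2 L 1 U →
      ∀ (E : ℕ → ℝ) (n : ℕ), E = groundEnergy Hm → n = 2 * ⌊(1 - δ) * (L : ℝ) ^ 2 / 2⌋₊ →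
        E (n + 2) - (E n + E (n + 4)) / 2 ≤ C / (L : ℝ) ^ 2 ∧
          E (n - 2) - (E n + E (n - 4)) / 2 ≤ C / (L : ℝ) ^ 2)
    (hno : ∀ a : ℝ, 0 < a → ∀ L₁ : ℕ, ∃ L ≥ L₁, Even L ∧ ∃ ψ : Fock (Orb (FermionTorus 2 L)),
      IsGroundStateInSector (hubbardTorus 2 L 1 U) (2 * ⌊(1 - δ) * (L : ℝ) ^ 2 / 2⌋₊) 0 ψ ∧
      star ψ ⬝ᵥ ψ = 1 ∧
      ∀ v : Orb (FermionTorus 2 L) × Orb (FermionTorus 2 L) → ℂ, star v ⬝ᵥ v = 1 →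
        (star v ⬝ᵥ Matrix.mulVec (twoParticleRDM ψ) v).re < a * (L : ℝ) ^ 2) :
    ¬ IncommensurateRigidity := by
  intro hR
  obtain ⟨a, ha, L₁, hY⟩ := hR U δ hU hδ h1 h2 h3 h4
  obtain ⟨L, hL, hev, ψ, hgs, hn, hlt⟩ := hno a ha L₁
  obtain ⟨v, hv, hav⟩ := hY L hL hev _ rfl ψ hgs hn
  exact absurd hav (not_le.mpr (hlt v hv))

/-- **A concrete sufficient condition for (¬Y): sub-macroscopic pair eigenvalues infinitely often.**
If at `(U, δ)` there is `C` such that for infinitely many even `L` some normalised `(N_L,0)`-sector ground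
state has `Re v†ρ₂(ψ)v ≤ C·L` for every unit `v` (all pair eigenvalues `O(L)` — e.g. `O(1)` as in an
insulator or a Fermi liquid, Yang's bound being `O(L²)`), then R's conclusion fails at `(U, δ)` in the
form (¬Y) used by `ParityGappedNonsuperconductingWindow` (take `L > C/a`). [folklore] -/
theorem noYangODLRO_of_linearPairBound (U δ : ℝ) {C : ℝ}
    (hC : ∀ L₁ : ℕ, ∃ L ≥ L₁, Even L ∧ ∃ ψ : Fock (Orb (FermionTorus 2 L)),
      IsGroundStateInSector (hubbardTorus 2 L 1 U) (2 * ⌊(1 - δ) * (L : ℝ) ^ 2 / 2⌋₊) 0 ψ ∧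
      star ψ ⬝ᵥ ψ = 1 ∧
      ∀ v : Orb (FermionTorus 2 L) × Orb (FermionTorus 2 L) → ℂ, star v ⬝ᵥ v = 1 →
        (star v ⬝ᵥ Matrix.mulVec (twoParticleRDM ψ) v).re ≤ C * (L : ℝ)) :
    ∀ a : ℝ, 0 < a → ∀ L₁ : ℕ, ∃ L ≥ L₁, Even L ∧ ∃ ψ : Fock (Orb (FermionTorus 2 L)),
      IsGroundStateInSector (hubbardTorus 2 L 1 U) (2 * ⌊(1 - δ) * (L : ℝ) ^ 2 / 2⌋₊) 0 ψ ∧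
      star ψ ⬝ᵥ ψ = 1 ∧
      ∀ v : Orb (FermionTorus 2 L) × Orb (FermionTorus 2 L) → ℂ, star v ⬝ᵥ v = 1 →
        (star v ⬝ᵥ Matrix.mulVec (twoParticleRDM ψ) v).re < a * (L : ℝ) ^ 2 := by
  intro a ha L₁
  -- an even side beyond both `L₁` and `C / a`
  obtain ⟨M, hM⟩ := exists_nat_gt (C / a)
  obtain ⟨L, hL, hev, ψ, hgs, hn, hle⟩ := hC (max L₁ (M + 1))
  refine ⟨L, le_trans (le_max_left _ _) hL, hev, ψ, hgs, hn, fun v hv => ?_⟩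
  have hLM : (M : ℝ) + 1 ≤ L := by exact_mod_cast le_trans (le_max_right _ _) hL
  have hLpos : (0 : ℝ) < L := by linarith [(Nat.cast_nonneg M : (0 : ℝ) ≤ M)]
  have hCL : C < a * (L : ℝ) := by
    have h1 : C / a < L := by linarith
    rwa [div_lt_iff₀ ha, mul_comm] at h1
  calc (star v ⬝ᵥ Matrix.mulVec (twoParticleRDM ψ) v).re ≤ C * (L : ℝ) := hle v hv
    _ < a * (L : ℝ) * (L : ℝ) := mul_lt_mul_of_pos_right hCL hLpos
    _ = a * (L : ℝ) ^ 2 := by ring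

/-- **Corollary: a parity-gapped (H2)–(H4) window whose ground states have `O(L)` pair eigenvalues
infinitely often refutes R** (`ParityGappedNonsuperconductingWindow` with (¬Y) supplied by
`noYangODLRO_of_linearPairBound`). [folklore] -/
theorem IncommensurateRigidity_false_of_parityGap_of_linearPairBound (U δ : ℝ) (hU : 0 < U)
    (hδ : δ ∈ Set.Ioo (0 : ℝ) (1 / 2))
    (hPG : ∃ Δ : ℝ, 0 < Δ ∧ ∃ L₀ : ℕ, ∀ L ≥ L₀, Even L → ∀ Hm, Hm = hubbardTorus 2 L 1 U →
      2 * Δ ≤ groundEnergy Hm (2 * ⌊(1 - δ) * (L : ℝ) ^ 2 / 2⌋₊ + 1) +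
        groundEnergy Hm (2 * ⌊(1 - δ) * (L : ℝ) ^ 2 / 2⌋₊ - 1) -
        2 * Matrix.minEnergyOn Hm (szSector (2 * ⌊(1 - δ) * (L : ℝ) ^ 2 / 2⌋₊) 0))
    (h2 : ∃ C : ℝ, ∃ L₀ : ℕ, ∀ L ≥ L₀, Even L → ∀ Hm, Hm = hubbardTorus 2 L 1 U → ∀ ψ,
      IsGroundStateInSector Hm (2 * ⌊(1 - δ) * (L : ℝ) ^ 2 / 2⌋₊) 0 ψ → star ψ ⬝ᵥ ψ = 1 →
      ∀ a : Orb (FermionTorus 2 L) × Orb (FermionTorus 2 L) → ℂ, (∀ p, ‖a p‖ ≤ 1) →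
        (∀ p, a p ≠ 0 → torusDist (ofLex p.1).1.toTorusSite (ofLex p.2).1.toTorusSite ≤ 1) →
        (expect (Matrix.conjTranspose (∑ p, a p • (creation p.1 * annihilation p.2)) *
            (∑ p, a p • (creation p.1 * annihilation p.2))) ψ).re -
          ‖expect (∑ p, a p • (creation p.1 * annihilation p.2)) ψ‖ ^ 2 ≤ C * (L : ℝ) ^ 2)
    (h3 : ∃ c : ℝ, 0 < c ∧ ∃ D L₀ : ℕ, ∀ L ≥ L₀, Even L → ∀ Hm, Hm = hubbardTorus 2 L 1 U →
      ∀ V : Submodule ℂ (Fock (Orb (FermionTorus 2 L))),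
        V ≤ szSector (2 * ⌊(1 - δ) * (L : ℝ) ^ 2 / 2⌋₊) 0 →
        (∀ φ ∈ V, (star φ ⬝ᵥ Matrix.mulVec Hm φ).re ≤
          (Matrix.minEnergyOn Hm (szSector (2 * ⌊(1 - δ) * (L : ℝ) ^ 2 / 2⌋₊) 0) + c / (L : ℝ)) *
            (star φ ⬝ᵥ φ).re) →
        Module.finrank ℂ V ≤ D)
    (h4 : ∃ C : ℝ, ∃ L₀ : ℕ, ∀ L ≥ L₀, Even L → ∀ Hm, Hm = hubbardTorus 2 L 1 U →
      ∀ (E : ℕ → ℝ) (n : ℕ), E = groundEnergy Hm → n = 2 * ⌊(1 - δ) * (L : ℝ) ^ 2 / 2⌋₊ →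
        E (n + 2) - (E n + E (n + 4)) / 2 ≤ C / (L : ℝ) ^ 2 ∧
          E (n - 2) - (E n + E (n - 4)) / 2 ≤ C / (L : ℝ) ^ 2)
    {C : ℝ}
    (hC : ∀ L₁ : ℕ, ∃ L ≥ L₁, Even L ∧ ∃ ψ : Fock (Orb (FermionTorus 2 L)),
      IsGroundStateInSector (hubbardTorus 2 L 1 U) (2 * ⌊(1 - δ) * (L : ℝ) ^ 2 / 2⌋₊) 0 ψ ∧
      star ψ ⬝ᵥ ψ = 1 ∧
      ∀ v : Orb (FermionTorus 2 L) × Orb (FermionTorus 2 L) → ℂ, star v ⬝ᵥ v = 1 →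
        (star v ⬝ᵥ Matrix.mulVec (twoParticleRDM ψ) v).re ≤ C * (L : ℝ)) :
    ¬ IncommensurateRigidity :=
  IncommensurateRigidity_false_of_ParityGappedNonsuperconductingWindow
    ⟨U, hU, δ, hδ, hPG, h2, h3, h4, noYangODLRO_of_linearPairBound U δ hC⟩

/-- **Where H can live, modulo the filed named conjecture `EtsTrichotomy` (stmt-1458).** NOT at
irrational doping with finite-range normal fluctuations: if `δ` is irrational and (H2) holds at EVERY
finite range `r` (constant `C_r`), then the parity gap already forces uniform Yang ODLRO at `(U, δ)`
(`yangODLRO_of_etsTrichotomy_of_finiteRangeFluctuations`, lead c9, via `parityGapClustering_proof` for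
(H1)), so (¬Y) is impossible there. Hence, modulo stmt-1458, a refuting window of
`ParityGappedNonsuperconductingWindow`-type requires RATIONAL `δ` or a particle–hole density wave
supported only in ranges `≥ 2` — exactly the two places where R as typed exceeds `EtsTrichotomy`. [folklore] -/
theorem not_irrational_finiteRange_window_of_etsTrichotomy
    (hE : Summit.HubbardSuperconductivity.HubbardSuperconductivity.Theses.AnomalyExhaustion.EtsTrichotomy) :
    ¬ ∃ U : ℝ, 0 < U ∧ ∃ δ ∈ Set.Ioo (0 : ℝ) (1 / 2), Irrational δ ∧
      (∃ Δ : ℝ, 0 < Δ ∧ ∃ L₀ : ℕ, ∀ L ≥ L₀, Even L → ∀ Hm, Hm = hubbardTorus 2 L 1 U →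
        2 * Δ ≤ groundEnergy Hm (2 * ⌊(1 - δ) * (L : ℝ) ^ 2 / 2⌋₊ + 1) +
          groundEnergy Hm (2 * ⌊(1 - δ) * (L : ℝ) ^ 2 / 2⌋₊ - 1) -
          2 * Matrix.minEnergyOn Hm (szSector (2 * ⌊(1 - δ) * (L : ℝ) ^ 2 / 2⌋₊) 0)) ∧
      (∀ r : ℕ, ∃ C : ℝ, ∃ L₀ : ℕ, ∀ L ≥ L₀, Even L → ∀ Hm, Hm = hubbardTorus 2 L 1 U → ∀ ψ,
        IsGroundStateInSector Hm (2 * ⌊(1 - δ) * (L : ℝ) ^ 2 / 2⌋₊) 0 ψ → star ψ ⬝ᵥ ψ = 1 →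
        ∀ a : Orb (FermionTorus 2 L) × Orb (FermionTorus 2 L) → ℂ, (∀ p, ‖a p‖ ≤ 1) →
          (∀ p, a p ≠ 0 → torusDist (ofLex p.1).1.toTorusSite (ofLex p.2).1.toTorusSite ≤ r) →
          (expect (Matrix.conjTranspose (∑ p, a p • (creation p.1 * annihilation p.2)) *
              (∑ p, a p • (creation p.1 * annihilation p.2))) ψ).re -
            ‖expect (∑ p, a p • (creation p.1 * annihilation p.2)) ψ‖ ^ 2 ≤ C * (L : ℝ) ^ 2) ∧
      (∀ a : ℝ, 0 < a → ∀ L₁ : ℕ, ∃ L ≥ L₁, Even L ∧ ∃ ψ : Fock (Orb (FermionTorus 2 L)),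
        IsGroundStateInSector (hubbardTorus 2 L 1 U) (2 * ⌊(1 - δ) * (L : ℝ) ^ 2 / 2⌋₊) 0 ψ ∧
        star ψ ⬝ᵥ ψ = 1 ∧
        ∀ v : Orb (FermionTorus 2 L) × Orb (FermionTorus 2 L) → ℂ, star v ⬝ᵥ v = 1 →
          (star v ⬝ᵥ Matrix.mulVec (twoParticleRDM ψ) v).re < a * (L : ℝ) ^ 2) := by
  rintro ⟨U, hU, δ, hδ, hirr, ⟨Δ, hΔ, L₀, hPG⟩, h2, hno⟩
  obtain ⟨a, ha, L₁, hY⟩ :=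
    Summit.HubbardSuperconductivity.IncommensurateRigidity.Birth.yangODLRO_of_etsTrichotomy_of_finiteRangeFluctuations
      hE U δ hU hδ hirr (expDecayRDM_of_parityGap U δ hΔ hPG) h2
  obtain ⟨L, hL, hev, ψ, hgs, hn, hlt⟩ := hno a ha L₁
  obtain ⟨v, hv, hav⟩ := hY L hL hev _ rfl ψ hgs hn
  exact absurd hav (not_le.mpr (hlt v hv))

end Summit.HubbardSuperconductivity.HubbardSuperconductivity.Theorems.IncommensurateRigidity.Negative

end
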